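/-
Copyright (c) 2026 the pub-hodgecm-mathlib formalisation cell (harness21).  Prover seat hodgecm-mathlib-K2E1-p10 (g0), Track B ∕ K2-LIT, h413 = `stmt-HodgeConjecture-24833`,
line `K2_E1_TraceFormulaBeta`, campaign «EIS-WHITTAKER-3», «C2₃∕C3₃ CONCRETE» FILE F3 = THE ASSEMBLY (dealer K2E1-plan (g5) 2026-09-04T09:23:57Z ∕ «=» 09:42:12Z (3); REPORT-FIRST
09:44Z, ORDER CHANGE 09:51Z «F3 hypothesis-first now»): the W5₃-FINAL letters `hWhol`, `hWbd` DISCHARGED and `hWeq` at `g = k` REDUCED to the two standing letters of ★ U3C.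
-/
import Summits.HodgeConjecture.HodgeConjecture.Theorems.K2E1WhittakerTokenWindowU3               -- ★ F1 (this seat, p859101): the token is holomorphic on the window and bounded by the local mean
import Summits.HodgeConjecture.HodgeConjecture.Theorems.K2E1WhittakerCoefficientEulerProductU3C   -- ★ (U3C-b) (K2E2-p12, p859042): the Whittaker coefficient at `g = k` = `c₀·A·(∏_S W_v)·D^S⁻¹`
import Summits.HodgeConjecture.HodgeConjecture.Theorems.K2E1WhittakerBoundsAssemblyU3            -- ★ C3₃-A (this seat, p858874): `whittaker_hWhol_hWbd_of_letters`
import Summits.HodgeConjecture.HodgeConjecture.Theorems.K2E1WhittakerFinitePartU3                -- ★ C2₃-A (this seat, p858801): `exists_finitePart_bounds_of_packages_cm`; brings ★ p858784 growth lemmas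
import Summits.HodgeConjecture.HodgeConjecture.Theorems.K2E1WhittakerDenBoundsUniformU3           -- ★ DEN-BOUNDS-UNIFORM₃ (K2E4-p10): `norm_den_inv_le_uniform_cm`; brings ★ W3₃-A `differentiableOn_den_inv_cm`
import Summits.HodgeConjecture.HodgeConjecture.Theorems.K2E1WhittakerShellIndexU3                -- ★ F3-prep (this seat): `m = 1` comparison, shell index bookkeeping
import Literature.NumberTheory.Automorphic.QuaternionAlgebraAdelicRamificationProofs              -- ★ `finite_setOf_valuation_ne_one` (a nonzero `ξ` is a unit at almost every place)
import HarnessLib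

/-!
# K2·E1 — `K2E1WhittakerContinuationConcreteU3` («C3₃ CONCRETE», THE ASSEMBLY): THE W5₃-FINAL LETTERS `hWhol`, `hWbd` FOR THE CONCRETE WHITTAKER COEFFICIENT OF THE
# SPHERICAL FLAT SECTION OF `U(2,1)_{L∕L⁺}`, AND `hWeq` AT `g = k ∈ K_U` MODULO THE TWO STANDING LETTERS OF ★ U3C (`hW` unit values off `S(ξ)`, `hfin`)

Track B ∕ K2-LIT, crux h413 = `stmt-HodgeConjecture-24833`, route of record `HCCMUnconditional`; cell `hodgecm-mathlib`, squad K2, ENGINE E1 (campaign «EIS-WHITTAKER-3»).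
THEOREMS ONLY (no `def`, no `instance`, no notation, no named-fact hypothesis, no `sorry`; default heartbeats); lane `--supports stmt-HodgeConjecture-24833 --as helper` (count-neutral).
Currency: ★ U3C `exists_pos_whittakerCoeff_eq_arch_mul_eulerProduct_cm_three` (the `ξ`-th Whittaker coefficient at `g = k` as `c₀ · A(ξ,z) · (∏_{v ∈ S} W_v(ξ,z)) · D^S(z)⁻¹`, letters
`hW`, `hfin`), ★ F1 `K2E1WhittakerTokenWindowU3` (the token `W_v(ξ, z)` is holomorphic on the window and bounded by the untwisted local mean), ★ C2₃-A `exists_finitePart_bounds_of_packages_cm`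
(finite part from per-place packages), ★ C3₃-A `whittaker_hWhol_hWbd_of_letters` (the exponential-times-polynomial bound `hWbd` and `hWhol` from the letters `c, A, F, D`), ★ W3₃-A
`differentiableOn_den_inv_cm` and ★ DEN-BOUNDS-UNIFORM₃ `norm_den_inv_le_uniform_cm` (the normaliser `D^S(z)⁻¹`), ★ W5₃-FINAL `sphericalEisenstein_continuation_cm_three_of_layers` :137 (the
CONSUMER: its letter shapes `hWhol`, `hWbd`, `hWeq` are reproduced VERBATIM).

THE MATHEMATICS [Garrett2018, §2.8; Bump1997, §3.7; MoeglinWaldspurger1995, I.2.10; TateThesis1967, §3.3].  Put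
`W(z, ξ) := 0` for `ξ = 0` and `W(z, ξ) := c₀ · A(ξ, z) · (∏_{v ∈ S(ξ)} W°_v(ξ, z)) · D^{S(ξ)}(z)⁻¹` otherwise, where `S(ξ) := S₀ ∪ {v : ξ is not a unit at some w ∣ v}` and `W°_v(ξ, ·)` is the token
`W_v(ξ, ·)` of ★ U3B∕U3C when `ξ` lies in the box `∏_w 𝔭_w^{e_w}` above `v` and `0` otherwise (the box BAKED IN).  The per-place packages of ★ C2₃-A hold for `W°`: holomorphy on the window
(★ F1: at good places from ★ (3-iii-b1)'s integrability, at the finitely many `v ∈ S₀` from the integrability letter `hT`), the TRIVIAL bound `‖W_v‖ ≤` local mean `≤ 8∕[(1−2^{1−σ₁})²(1−2^{2−2σ₁})]`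
uniformly at good places (★ F1) — which IS of C2₃-A's shape `(∏_{w∣v} weight_w)^k` because a place `v ∈ S(ξ) ∖ S₀` carries a non-unit coordinate of the in-box `ξ`, i.e. a weight `≥ 4` (★ p858784
`four_le_prod_extension_ite_of_exists`, `4^k ≥` the uniform bound) — and a finite maximum over `S₀`; order honesty `hn` is the definition of the shell index `n(ξ, w) = ord_w ξ − e_w`; the vanishing
`hvan` off the box is built into `W°`.  Hence ★ C2₃-A gives the finite-part letters, ★ W3₃-A∕DEN-BOUNDS the `D`-letters, `c₀` is CONSTANT, the archimedean factor is ★ C3₃-A's with `ι = InfinitePlace L`,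
`dδ(w) = w(δ)`, `ξ_∞(ξ)(w) = w.embedding ξ`, `m = 1` (★ F3-prep `norm_mixedEmbedding_le_norm_embedding`), and ★ C3₃-A returns `hWhol`, `hWbd` for `W`.  Finally `hWeq` ON `{1 < Re z}` (⊇ W5₃'s `{2 < Re z}`):
for `ξ ≠ 0`, given ★ U3C's letters at `(ξ, z)` — `hfin` and the unit values `hW` off `S(ξ)` (i.e. at the good places where `ξ` is a unit; the shape (U3C-c) pays) — ★ U3C with `S₀ := S(ξ)` says the
coefficient is `c₀·A·(∏_{S(ξ)} W_v)·D^{S(ξ)}⁻¹`; if `ξ` is in the box everywhere this is `W(z,ξ)` termwise, and if `ξ_w ∉ 𝔭_w^{e_w}` for some `w` then BOTH sides vanish: `W` by construction and the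
token at `w.under ∈ S(ξ)` by the window-support letter `hvan` (the one analytic input not proved here: F2 `K2E1WhittakerTokenSupportU3`, after K2E2-p12's (U3C-c1) character dictionary).
* ONE HEAD **`exists_whittaker_letters_cm_three_of`** (bookkeeping — `m = 1`, shell index — in ★ F3-prep `K2E1WhittakerShellIndexU3`).
LETTERS OF THE HEAD (all named, each dischargeable separately): `hgood` (★ U3C's, for `v ∉ S₀`), `he`∕`he₀` (the box is trivial off the places above `S₀`), **`hT`** (integrability of `Q_v^{−σ}`,
`σ > 1`, at the finitely many `v ∈ S₀`), **`hvan`** (support on the window), and — inside `hWeq`, pointwise in `(z, ξ)` — ★ U3C's **`hfin`** and **`hW`**.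
HONEST LABEL: HC_CM is proved only modulo the 7 printed citations (2 remaining named inputs: hLiu418 = `stmt-HodgeConjecture-24832`, h413 = `stmt-HodgeConjecture-24833`)
until rung 0 closes; this file asserts no named fact, closes no socket and crosses no ceiling by itself; count-neutral.
References: [Garrett2018] P. Garrett, *Modern Analysis of Automorphic Forms by Example* (2018), §2.8 · [Bump1997] D. Bump, *Automorphic Forms and Representations*, §3.7 ·
[MoeglinWaldspurger1995] C. Mœglin, J.-L. Waldspurger, *Spectral Decomposition and Eisenstein Series*, I.2.10 · [TateThesis1967] J. Tate, *Fourier analysis in number fields*, §3.3.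
-/

set_option autoImplicit false
-- the mandated namespace repeats `HodgeConjecture.HodgeConjecture`, as in every `Theorems/*.lean` of this sub-problem
set_option linter.dupNamespace false

noncomputable section

open MeasureTheory MeasureTheory.Measure NumberField NumberField.InfinitePlace NumberField.mixedEmbedding IsDedekindDomain Set Filter Topology
open scoped NNReal ENNReal Real Classical
open Literature.NumberTheory.Automorphic Literature.NumberTheory.Automorphic.UnitaryGroup Literature.NumberTheory.GaloisRepresentations
open Literature.NumberTheory.GaloisRepresentations.IsNonarchimedeanLocalField Literature.NumberTheory.LFunctions
open Summit.HodgeConjecture.HodgeConjecture.Cruxes.H413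
open Summit.HodgeConjecture.HodgeConjecture.Cruxes.H413.K2E1BorelEisensteinU (flatSectionU)
open Summit.HodgeConjecture.HodgeConjecture.Cruxes.H413.K2E1WhittakerCoefficientEulerProductU3C (exists_pos_whittakerCoeff_eq_arch_mul_eulerProduct_cm_three)
open Summit.HodgeConjecture.HodgeConjecture.Cruxes.H413.K2E1WhittakerTokenWindowU3 (differentiableOn_token_of_integrable norm_token_le_of_integrable differentiableOn_token_of_good
  norm_token_le_uniform_of_good)
open Summit.HodgeConjecture.HodgeConjecture.Cruxes.H413.K2E1WhittakerBoundsAssemblyU3 (whittaker_hWhol_hWbd_of_letters)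
open Summit.HodgeConjecture.HodgeConjecture.Cruxes.H413.K2E1WhittakerFinitePartU3 (exists_finitePart_bounds_of_packages_cm)
open Summit.HodgeConjecture.HodgeConjecture.Cruxes.H413.K2E1WhittakerGrowthPlacesOverU3 (one_le_prod_extension_ite four_le_prod_extension_ite_of_exists)
open Summit.HodgeConjecture.HodgeConjecture.Cruxes.H413.K2E1WhittakerCoefficientEulerProductU3 (differentiableOn_den_inv_cm isUnitary_quadraticHeckeCharCM)
open Summit.HodgeConjecture.HodgeConjecture.Cruxes.H413.K2E1WhittakerDenBoundsUniformU3 (norm_den_inv_le_uniform_cm)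
open Summit.HodgeConjecture.HodgeConjecture.Cruxes.H413.K2E1WhittakerShellIndexU3

namespace Summit.HodgeConjecture.HodgeConjecture.Cruxes.H413.K2E1WhittakerContinuationConcreteU3

/-! ## HEAD: `hWhol`, `hWbd` discharged; `hWeq` at `g = k` modulo ★ U3C's letters -/

section Head

variable (L : Type) [Field L] [NumberField L] [IsCMField L] (hc : IsCMField.complexConj L * IsCMField.complexConj L = 1)
  {δ : L} (hcδ : IsCMField.complexConj L δ = -δ) (hδ : δ ≠ 0)
  {k : (quasiSplit (↥(maximalRealSubfield L)) L (IsCMField.complexConj L) 3).Adelic}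
  (hk : k ∈ ((standardMaximalCompactGL 3 L).comap (adelicVal ↥(maximalRealSubfield L) L (IsCMField.complexConj L) 3 ((StdForm.antidiagonal 3).over L)) : Subgroup (quasiSplit (↥(maximalRealSubfield L)) L (IsCMField.complexConj L) 3).Adelic))

include hc hk in
/-- **C2₃∕C3₃ CONCRETE — THE W5₃-FINAL LETTERS FOR THE CONCRETE WHITTAKER COEFFICIENT.**  In the frame of ★ U3C (`μ_E = σ_E,*(vol ⊗ μ_{E,f})`, `μ_F = σ_F,*(vol ⊗ μ_{F,f})`, local Haar
measures `ν_v`, `k ∈ K_U`, `φ₀`), for a finset `S₀` of places of `L⁺` off which every place is good (`hgood`), a box `e` trivial above `S₀ᶜ` (`he`, `he₀`), the integrability letter `hT` at the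
places of `S₀` and the window-support letter `hvan`: THERE IS `W : ℂ → L → ℂ` with
(1) **`hWhol`** `∀ ξ ≠ 0, DifferentiableOn ℂ (W · ξ) {1 < Re z}`; (2) **`hWbd`** (★ W5₃-FINAL's shape verbatim: `M·e^{−b‖ξ_∞‖}(1+‖ξ_∞‖)^a` near every `z₀` of the window, and `W(z, ξ) = 0` for `ξ_f`
off a compact `C_f`); (3) **`hWeq` ON `{1 < Re z}` MODULO ★ U3C's LETTERS**: for `1 < Re z` and `ξ ≠ 0`, IF `hfin(z)` and the unit values `W_v(ξ, z) = (1−q_v^{−z})(1−ε_v q_v^{−z})(1−ε_v q_v^{−(2z−1)})`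
hold at every good `v ∉ S₀` above which `ξ` is a unit, THEN `W(z, ξ) = μ_E(D_E)⁻¹ · 𝓕_E[X ↦ μ_F(D_F)⁻¹·∫_t f_z(ι(w₀)·u(X, θt)·k) dμ_F](ξ)` — ★ U3C's left-hand side, i.e. the right-hand side of
W5₃-FINAL's `hWeq` at `g = k`.  (`W(z, ξ) = c₀·A(ξ,z)·∏_{v ∈ S(ξ)} W°_v(ξ,z)·D^{S(ξ)}(z)⁻¹`, `S(ξ) = S₀ ∪ {non-unit places of ξ}`, `W°` = token with the box baked in; ★ C2₃-A + ★ C3₃-A + ★ F1 +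
★ W3₃-A∕DEN-BOUNDS + ★ U3C.) [cite: Garrett2018, §2.8] [cite: Bump1997, §3.7] [cite: MoeglinWaldspurger1995, I.2.10] [cite: TateThesis1967, §3.3, Thm 3.3.1] -/
theorem exists_whittaker_letters_cm_three_of {d : ↥(maximalRealSubfield L)} (hd : δ * δ = algebraMap ↥(maximalRealSubfield L) L d)
    [MeasurableSpace (AdeleRing (𝓞 L) L)] [BorelSpace (AdeleRing (𝓞 L) L)]
    [MeasurableSpace (AdeleRing (𝓞 ↥(maximalRealSubfield L)) ↥(maximalRealSubfield L))] [BorelSpace (AdeleRing (𝓞 ↥(maximalRealSubfield L)) ↥(maximalRealSubfield L))]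
    [MeasurableSpace (FiniteAdeleRing (𝓞 L) L)] [BorelSpace (FiniteAdeleRing (𝓞 L) L)]
    [MeasurableSpace (FiniteAdeleRing (𝓞 ↥(maximalRealSubfield L)) ↥(maximalRealSubfield L))] [BorelSpace (FiniteAdeleRing (𝓞 ↥(maximalRealSubfield L)) ↥(maximalRealSubfield L))]
    [∀ v : HeightOneSpectrum (𝓞 ↥(maximalRealSubfield L)), MeasurableSpace (v.adicCompletion ↥(maximalRealSubfield L))] [∀ v : HeightOneSpectrum (𝓞 ↥(maximalRealSubfield L)), BorelSpace (v.adicCompletion ↥(maximalRealSubfield L))]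
    (μEf : Measure (FiniteAdeleRing (𝓞 L) L)) [μEf.IsAddHaarMeasure] (μFf : Measure (FiniteAdeleRing (𝓞 ↥(maximalRealSubfield L)) ↥(maximalRealSubfield L))) [μFf.IsAddHaarMeasure]
    (νv : ∀ v : HeightOneSpectrum (𝓞 ↥(maximalRealSubfield L)), Measure (v.adicCompletion ↥(maximalRealSubfield L))) [∀ v, (νv v).IsAddHaarMeasure]
    {σE : mixedSpace L × FiniteAdeleRing (𝓞 L) L → AdeleRing (𝓞 L) L} (hσE : ∀ p, (σE p).1 = (InfiniteAdeleRing.ringEquiv_mixedSpace L).symm p.1 ∧ (σE p).2 = p.2)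
    {σF : mixedSpace ↥(maximalRealSubfield L) × FiniteAdeleRing (𝓞 ↥(maximalRealSubfield L)) ↥(maximalRealSubfield L) → AdeleRing (𝓞 ↥(maximalRealSubfield L)) ↥(maximalRealSubfield L)} (hσF : ∀ p, (σF p).1 = (InfiniteAdeleRing.ringEquiv_mixedSpace ↥(maximalRealSubfield L)).symm p.1 ∧ (σF p).2 = p.2)
    (φ₀ : ℂ)
    (S₀ : Finset (HeightOneSpectrum (𝓞 ↥(maximalRealSubfield L))))
    (hgood : ∀ v ∉ S₀, Algebra.IsUnramifiedIn (𝓞 L) v.asIdeal ∧ Valued.v (2 : v.adicCompletion ↥(maximalRealSubfield L)) = 1 ∧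
        ∀ w : PlacesOver L v, Valued.v (algebraMap L (LocalRing L v) δ w) = 1)
    {e : HeightOneSpectrum (𝓞 L) → ℤ} (he : ∀ᶠ w in cofinite, e w = 0) (he₀ : ∀ w : HeightOneSpectrum (𝓞 L), e w ≠ 0 → w.under (𝓞 ↥(maximalRealSubfield L)) ∈ S₀)
    (hT : ∀ v ∈ S₀, ∀ σ : ℝ, 1 < σ → Integrable (fun p : Fin 3 → v.adicCompletion ↥(maximalRealSubfield L) =>
        (∏ w' : PlacesOver L v, max 1 (max ((normAbs (w'.1.adicCompletion L) (quadraticLocalEquiv L v (IsCMField.complexConj L) hcδ hδ (p 0, p 1) w') : ℝ≥0) : ℝ)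
          ((normAbs (w'.1.adicCompletion L) ((toLocalRing L v (p 2) * algebraMap L (LocalRing L v) δ -
            toLocalRing L v 2⁻¹ * (quadraticLocalEquiv L v (IsCMField.complexConj L) hcδ hδ (p 0, p 1) *
              conjLocal L (IsCMField.complexConj L) v (quadraticLocalEquiv L v (IsCMField.complexConj L) hcδ hδ (p 0, p 1)))) w') : ℝ≥0) : ℝ))) ^ (-σ))
      (Measure.pi fun _ : Fin 3 => νv v))
    (hvan : ∀ ξ : L, ξ ≠ 0 → ∀ w : HeightOneSpectrum (𝓞 L), (ξ : w.adicCompletion L) ∉ primePowBall (w.adicCompletion L) (e w) → ∀ z : ℂ, 1 < z.re →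
      ((Measure.pi fun _ : Fin 3 => νv (w.under (𝓞 ↥(maximalRealSubfield L)))) (integralBox ↥(maximalRealSubfield L) (Fin 3) (w.under (𝓞 ↥(maximalRealSubfield L))))).toReal⁻¹ •
          ∫ p : Fin 3 → (w.under (𝓞 ↥(maximalRealSubfield L))).adicCompletion ↥(maximalRealSubfield L),
            ((((∏ w' : PlacesOver L (w.under (𝓞 ↥(maximalRealSubfield L))), max 1 (max ((normAbs (w'.1.adicCompletion L) (quadraticLocalEquiv L (w.under (𝓞 ↥(maximalRealSubfield L))) (IsCMField.complexConj L) hcδ hδ (p 0, p 1) w') : ℝ≥0) : ℝ)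
          ((normAbs (w'.1.adicCompletion L) ((toLocalRing L (w.under (𝓞 ↥(maximalRealSubfield L))) (p 2) * algebraMap L (LocalRing L (w.under (𝓞 ↥(maximalRealSubfield L)))) δ -
            toLocalRing L (w.under (𝓞 ↥(maximalRealSubfield L))) 2⁻¹ * (quadraticLocalEquiv L (w.under (𝓞 ↥(maximalRealSubfield L))) (IsCMField.complexConj L) hcδ hδ (p 0, p 1) *
              conjLocal L (IsCMField.complexConj L) (w.under (𝓞 ↥(maximalRealSubfield L))) (quadraticLocalEquiv L (w.under (𝓞 ↥(maximalRealSubfield L))) (IsCMField.complexConj L) hcδ hδ (p 0, p 1)))) w') : ℝ≥0) : ℝ))) : ℝ) : ℂ) ^ (-z)) *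
              (∏ w' : PlacesOver L (w.under (𝓞 ↥(maximalRealSubfield L))), (adeleAddCharAt L w'.1 ((ξ : w'.1.adicCompletion L) * quadraticLocalEquiv L (w.under (𝓞 ↥(maximalRealSubfield L))) (IsCMField.complexConj L) hcδ hδ (p 0, p 1) w') : ℂ))
            ∂(Measure.pi fun _ : Fin 3 => νv (w.under (𝓞 ↥(maximalRealSubfield L)))) = 0) :
    ∃ W : ℂ → L → ℂ,
      (∀ ξ : L, ξ ≠ 0 → DifferentiableOn ℂ (fun z => W z ξ) {z : ℂ | 1 < z.re}) ∧
      (∀ z₀ ∈ {z : ℂ | 1 < z.re}, ∃ V ∈ 𝓝 z₀, ∃ (M b a : ℝ) (Cf : Set (FiniteAdeleRing (𝓞 L) L)), 0 ≤ M ∧ 0 < b ∧ IsCompact Cf ∧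
        ∀ z ∈ V, ∀ ξ : L,
          ‖W z ξ‖ ≤ M * Real.exp (-(b * ‖InfiniteAdeleRing.ringEquiv_mixedSpace L (algebraMap L (AdeleRing (𝓞 L) L) ξ).1‖)) *
            (1 + ‖InfiniteAdeleRing.ringEquiv_mixedSpace L (algebraMap L (AdeleRing (𝓞 L) L) ξ).1‖) ^ a ∧
          ((algebraMap L (AdeleRing (𝓞 L) L) ξ).2 ∉ Cf → W z ξ = 0)) ∧
      (∀ z : ℂ, 1 < z.re → ∀ ξ : L, ξ ≠ 0 →
        Integrable (fun q : FiniteAdeleRing (𝓞 L) L × FiniteAdeleRing (𝓞 ↥(maximalRealSubfield L)) ↥(maximalRealSubfield L) => ((((∏ᶠ w : HeightOneSpectrum (𝓞 L), max 1 (max ‖((((0 : InfiniteAdeleRing L)), q.1) : AdeleRing (𝓞 L) L).2 w‖₊ ‖(heisZ (c := IsCMField.complexConj L) ((((0 : InfiniteAdeleRing L)), q.1) : AdeleRing (𝓞 L) L) ((traceZeroLine ↥(maximalRealSubfield L) L (IsCMField.complexConj L) hcδ hδ ((0, q.2) : AdeleRing (𝓞 ↥(maximalRealSubfield L)) ↥(maximalRealSubfield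 L)) : traceZeroAdele ↥(maximalRealSubfield L) L (IsCMField.complexConj L)) : AdeleRing (𝓞 L) L)).2 w‖₊) : ℝ≥0) : ℝ) : ℂ) ^ (-z))) (μEf.prod μFf) →
        (∀ v : HeightOneSpectrum (𝓞 ↥(maximalRealSubfield L)), v ∉ S₀ → (∀ w' : PlacesOver L v, w'.1.valuation L ξ = 1) →
          ((Measure.pi fun _ : Fin 3 => νv v) (integralBox ↥(maximalRealSubfield L) (Fin 3) v)).toReal⁻¹ •
          ∫ p : Fin 3 → v.adicCompletion ↥(maximalRealSubfield L),
            ((((∏ w' : PlacesOver L v, max 1 (max ((normAbs (w'.1.adicCompletion L) (quadraticLocalEquiv L v (IsCMField.complexConj L) hcδ hδ (p 0, p 1) w') : ℝ≥0) : ℝ)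
          ((normAbs (w'.1.adicCompletion L) ((toLocalRing L v (p 2) * algebraMap L (LocalRing L v) δ -
            toLocalRing L v 2⁻¹ * (quadraticLocalEquiv L v (IsCMField.complexConj L) hcδ hδ (p 0, p 1) *
              conjLocal L (IsCMField.complexConj L) v (quadraticLocalEquiv L v (IsCMField.complexConj L) hcδ hδ (p 0, p 1)))) w') : ℝ≥0) : ℝ))) : ℝ) : ℂ) ^ (-z)) *
              (∏ w' : PlacesOver L v, (adeleAddCharAt L w'.1 ((ξ : w'.1.adicCompletion L) * quadraticLocalEquiv L v (IsCMField.complexConj L) hcδ hδ (p 0, p 1) w') : ℂ))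
            ∂(Measure.pi fun _ : Fin 3 => νv v) =
          (1 - (v.residueCard : ℂ) ^ (-z)) * (1 - (quadraticHeckeCharCM L).valueAtUniformizer v * (v.residueCard : ℂ) ^ (-z)) *
        (1 - (quadraticHeckeCharCM L).valueAtUniformizer v * (v.residueCard : ℂ) ^ (-(2 * z - 1)))) →
        W z ξ =
        ((((((volume : Measure (mixedSpace L)).prod μEf).map σE) (adeleFundamentalDomain L)).toReal⁻¹ : ℝ) : ℂ) *
          adeleFourierCoeff (((volume : Measure (mixedSpace L)).prod μEf).map σE)
            (fun X : AdeleRing (𝓞 L) L => ((((((volume : Measure (mixedSpace ↥(maximalRealSubfield L))).prod μFf).map σF) (adeleFundamentalDomain ↥(maximalRealSubfield L))).toReal⁻¹ : ℝ) : ℂ) *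
              ∫ t : AdeleRing (𝓞 ↥(maximalRealSubfield L)) ↥(maximalRealSubfield L), flatSectionU (fun _ : (quasiSplit (↥(maximalRealSubfield L)) L (IsCMField.complexConj L) 3).Adelic => φ₀) z (((quasiSplit (↥(maximalRealSubfield L)) L (IsCMField.complexConj L) 3).toAdelic (weylLongU ((IsCMField.complexConj L : L ≃ₐ[↥(maximalRealSubfield L)] L) : L →+* L) (rfl : ((StdForm.antidiagonal 3).over L) = ((StdForm.antidiagonal 3).over L)))) * (((heisChart hc (X, traceZeroLine ↥(maximalRealSubfield L) L (IsCMField.complexConj L) hcδ hδ t)) : ↥(adelicUnipotent ↥(maximalRealSubfield L) L (IsCMField.complexConj L) 3)) : (quasiSplit (↥(maximalRealSubfield L)) L (IsCMField.complexConj L) 3).Adelic) * k) ∂(((volume : Measure (mixedSpace ↥(maximalRealSubfield L))).prod μFf).map σF)) ξ) := by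
  haveI : Algebra.IsQuadraticExtension ↥(maximalRealSubfield L) L := IsCMField.isQuadraticExtension L
  have hU : IsOpen {z : ℂ | 1 < z.re} := isOpen_lt continuous_const Complex.continuous_re
  -- (0) ★ U3C's constant
  obtain ⟨C', -, hU3C⟩ := exists_pos_whittakerCoeff_eq_arch_mul_eulerProduct_cm_three L hc hcδ hδ hk hd μEf μFf νv hσE hσF φ₀
  -- (1) the finite set `S(ξ) = S₀ ∪ {non-unit places of ξ}` and its three properties
  have hfinite : ∀ ξ : L, ξ ≠ 0 → {w : HeightOneSpectrum (𝓞 L) | w.valuation L ξ ≠ 1}.Finite := fun ξ hξ => finite_setOf_valuation_ne_one L hξ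
  obtain ⟨S, hS⟩ : ∃ S : L → Finset (HeightOneSpectrum (𝓞 ↥(maximalRealSubfield L))), ∀ ξ : L, S ξ = if hξ : ξ = 0 then S₀ else
      S₀ ∪ (hfinite ξ hξ).toFinset.image (fun w : HeightOneSpectrum (𝓞 L) => w.under (𝓞 ↥(maximalRealSubfield L))) := ⟨_, fun _ => rfl⟩
  have hS₀ : ∀ ξ : L, S₀ ⊆ S ξ := by
    intro ξ; rw [hS]; split_ifs
    · exact Finset.Subset.refl _
    · exact Finset.subset_union_left
  have hSmem : ∀ ξ : L, ξ ≠ 0 → ∀ w : HeightOneSpectrum (𝓞 L), w.valuation L ξ ≠ 1 → w.under (𝓞 ↥(maximalRealSubfield L)) ∈ S ξ := by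
    intro ξ hξ w hw
    rw [hS, dif_neg hξ]
    exact Finset.mem_union_right _ (Finset.mem_image_of_mem _ ((hfinite ξ hξ).mem_toFinset.2 hw))
  have hSnot : ∀ ξ : L, ξ ≠ 0 → ∀ v : HeightOneSpectrum (𝓞 ↥(maximalRealSubfield L)), v ∉ S ξ → v ∉ S₀ ∧ ∀ w' : PlacesOver L v, w'.1.valuation L ξ = 1 := by
    intro ξ hξ v hv
    refine ⟨fun h => hv (hS₀ ξ h), fun w' => ?_⟩
    by_contra hne
    exact hv (w'.2 ▸ hSmem ξ hξ w'.1 hne)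
  have hSout : ∀ ξ : L, ξ ≠ 0 → ∀ v ∈ S ξ, v ∉ S₀ → ∃ w' : PlacesOver L v, w'.1.valuation L ξ ≠ 1 := by
    intro ξ hξ v hv hv₀
    rw [hS, dif_neg hξ, Finset.mem_union] at hv
    rcases hv with h | h
    · exact absurd h hv₀
    · obtain ⟨w, hw, rfl⟩ := Finset.mem_image.1 h
      exact ⟨⟨w, rfl⟩, (hfinite ξ hξ).mem_toFinset.1 hw⟩
  -- the box is trivial above `S₀ᶜ`
  have he_zero : ∀ {v : HeightOneSpectrum (𝓞 ↥(maximalRealSubfield L))}, v ∉ S₀ → ∀ w' : PlacesOver L v, e w'.1 = 0 := by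
    intro v hv w'
    by_contra h
    exact hv (w'.2 ▸ he₀ w'.1 h)
  -- (2) the token with the box baked in, and its four package letters
  obtain ⟨Wloc, hWloc⟩ : ∃ Wloc : L → HeightOneSpectrum (𝓞 ↥(maximalRealSubfield L)) → ℂ → ℂ, ∀ (ξ : L) (v : HeightOneSpectrum (𝓞 ↥(maximalRealSubfield L))) (z : ℂ), Wloc ξ v z =
      if (∀ w' : PlacesOver L v, (ξ : w'.1.adicCompletion L) ∈ primePowBall (w'.1.adicCompletion L) (e w'.1)) then
        ((Measure.pi fun _ : Fin 3 => νv v) (integralBox ↥(maximalRealSubfield L) (Fin 3) v)).toReal⁻¹ •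
          ∫ p : Fin 3 → v.adicCompletion ↥(maximalRealSubfield L),
            ((((∏ w' : PlacesOver L v, max 1 (max ((normAbs (w'.1.adicCompletion L) (quadraticLocalEquiv L v (IsCMField.complexConj L) hcδ hδ (p 0, p 1) w') : ℝ≥0) : ℝ)
          ((normAbs (w'.1.adicCompletion L) ((toLocalRing L v (p 2) * algebraMap L (LocalRing L v) δ -
            toLocalRing L v 2⁻¹ * (quadraticLocalEquiv L v (IsCMField.complexConj L) hcδ hδ (p 0, p 1) *
              conjLocal L (IsCMField.complexConj L) v (quadraticLocalEquiv L v (IsCMField.complexConj L) hcδ hδ (p 0, p 1)))) w') : ℝ≥0) : ℝ))) : ℝ) : ℂ) ^ (-z)) *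
              (∏ w' : PlacesOver L v, (adeleAddCharAt L w'.1 ((ξ : w'.1.adicCompletion L) * quadraticLocalEquiv L v (IsCMField.complexConj L) hcδ hδ (p 0, p 1) w') : ℂ))
            ∂(Measure.pi fun _ : Fin 3 => νv v)
      else 0 := ⟨_, fun _ _ _ => rfl⟩
  -- (hhol)
  have hhol : ∀ ξ : L, ∀ v ∈ S ξ, DifferentiableOn ℂ (Wloc ξ v) {z : ℂ | 1 < z.re} := by
    intro ξ v _
    by_cases hbox : ∀ w' : PlacesOver L v, (ξ : w'.1.adicCompletion L) ∈ primePowBall (w'.1.adicCompletion L) (e w'.1)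
    · have hfun : Wloc ξ v = fun z => ((Measure.pi fun _ : Fin 3 => νv v) (integralBox ↥(maximalRealSubfield L) (Fin 3) v)).toReal⁻¹ •
          ∫ p : Fin 3 → v.adicCompletion ↥(maximalRealSubfield L),
            ((((∏ w' : PlacesOver L v, max 1 (max ((normAbs (w'.1.adicCompletion L) (quadraticLocalEquiv L v (IsCMField.complexConj L) hcδ hδ (p 0, p 1) w') : ℝ≥0) : ℝ)
          ((normAbs (w'.1.adicCompletion L) ((toLocalRing L v (p 2) * algebraMap L (LocalRing L v) δ -
            toLocalRing L v 2⁻¹ * (quadraticLocalEquiv L v (IsCMField.complexConj L) hcδ hδ (p 0, p 1) *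
              conjLocal L (IsCMField.complexConj L) v (quadraticLocalEquiv L v (IsCMField.complexConj L) hcδ hδ (p 0, p 1)))) w') : ℝ≥0) : ℝ))) : ℝ) : ℂ) ^ (-z)) *
              (∏ w' : PlacesOver L v, (adeleAddCharAt L w'.1 ((ξ : w'.1.adicCompletion L) * quadraticLocalEquiv L v (IsCMField.complexConj L) hcδ hδ (p 0, p 1) w') : ℂ))
            ∂(Measure.pi fun _ : Fin 3 => νv v) := funext fun z => by rw [hWloc, if_pos hbox]
      rw [hfun]
      by_cases hv₀ : v ∈ S₀
      · intro z₀ hz₀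
        have hz₀' : 1 < z₀.re := hz₀
        have hσ₁ : 1 < (1 + z₀.re) / 2 := by linarith
        have hmem : z₀ ∈ {z : ℂ | (1 + z₀.re) / 2 < z.re} := by show (1 + z₀.re) / 2 < z₀.re; linarith
        have hopen : IsOpen {z : ℂ | (1 + z₀.re) / 2 < z.re} := isOpen_lt continuous_const Complex.continuous_re
        exact ((differentiableOn_token_of_integrable L hcδ hδ v (νv v) (fun w' : PlacesOver L v => (ξ : w'.1.adicCompletion L)) (hT v hv₀ _ hσ₁)).differentiableAt
          (hopen.mem_nhds hmem)).differentiableWithinAt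
      · obtain ⟨hunr, h2, hδu⟩ := hgood v hv₀
        exact differentiableOn_token_of_good L hcδ hδ hd v (νv v) hunr h2 hδu fun w' : PlacesOver L v => (ξ : w'.1.adicCompletion L)
    · have hfun : Wloc ξ v = fun _ => 0 := funext fun z => by rw [hWloc, if_neg hbox]
      rw [hfun]
      exact differentiableOn_const _
  -- (hbd)
  have hbd : ∀ σ₁ : ℝ, 1 < σ₁ → ∃ (B : ℝ) (kk : ℕ), 1 ≤ B ∧ ∀ ξ : L, ξ ≠ 0 →
      (∀ w : HeightOneSpectrum (𝓞 L), (ξ : w.adicCompletion L) ∈ primePowBall (w.adicCompletion L) (e w)) →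
      ∀ v ∈ S ξ, ∀ z : ℂ, σ₁ ≤ z.re →
        ‖Wloc ξ v z‖ ≤ (if v ∈ S₀ then B else 1) *
          (letI := HeightOneSpectrum.Extension.fintype (𝓞 ↥(maximalRealSubfield L)) (↥(maximalRealSubfield L)) L (𝓞 L) v;
            ∏ w : v.Extension (𝓞 L), (if w.1 ∈ (∅ : Finset (HeightOneSpectrum (𝓞 L))) ∨ 1 ≤ (fun (ξ : L) (w : HeightOneSpectrum (𝓞 L)) => (-WithZero.log (w.valuation L ξ) - e w).toNat) ξ w.1 then
              2 * (((fun (ξ : L) (w : HeightOneSpectrum (𝓞 L)) => (-WithZero.log (w.valuation L ξ) - e w).toNat) ξ w.1 : ℝ) + 1) else 1)) ^ kk := by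
    intro σ₁ hσ₁
    obtain ⟨kk, hkk⟩ := pow_unbounded_of_one_lt (8 / ((1 - (2 : ℝ) ^ (-(σ₁ - 1))) ^ 2 * (1 - (2 : ℝ) ^ (-(2 * σ₁ - 2))))) (by norm_num : (1 : ℝ) < 4)
    -- the finite maximum over `S₀` of the untwisted local means
    set M : HeightOneSpectrum (𝓞 ↥(maximalRealSubfield L)) → ℝ := fun v =>
      ((Measure.pi fun _ : Fin 3 => νv v) (integralBox ↥(maximalRealSubfield L) (Fin 3) v)).toReal⁻¹ *
        ∫ p : Fin 3 → v.adicCompletion ↥(maximalRealSubfield L), (∏ w' : PlacesOver L v, max 1 (max ((normAbs (w'.1.adicCompletion L) (quadraticLocalEquiv L v (IsCMField.complexConj L) hcδ hδ (p 0, p 1) w') : ℝ≥0) : ℝ)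
          ((normAbs (w'.1.adicCompletion L) ((toLocalRing L v (p 2) * algebraMap L (LocalRing L v) δ -
            toLocalRing L v 2⁻¹ * (quadraticLocalEquiv L v (IsCMField.complexConj L) hcδ hδ (p 0, p 1) *
              conjLocal L (IsCMField.complexConj L) v (quadraticLocalEquiv L v (IsCMField.complexConj L) hcδ hδ (p 0, p 1)))) w') : ℝ≥0) : ℝ))) ^ (-σ₁) ∂(Measure.pi fun _ : Fin 3 => νv v) with hM
    have hM0 : ∀ v, 0 ≤ M v := fun v => mul_nonneg (inv_nonneg.2 ENNReal.toReal_nonneg)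
      (integral_nonneg fun p => Real.rpow_nonneg (zero_le_one.trans (Finset.one_le_prod fun w' _ => le_max_left _ _)) _)
    refine ⟨1 + ∑ v ∈ S₀, M v, kk, le_add_of_nonneg_right (Finset.sum_nonneg fun v _ => hM0 v), fun ξ hξ hbox v hv z hz => ?_⟩
    letI := HeightOneSpectrum.Extension.fintype (𝓞 ↥(maximalRealSubfield L)) (↥(maximalRealSubfield L)) L (𝓞 L) v
    have hWv : Wloc ξ v z = ((Measure.pi fun _ : Fin 3 => νv v) (integralBox ↥(maximalRealSubfield L) (Fin 3) v)).toReal⁻¹ •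
          ∫ p : Fin 3 → v.adicCompletion ↥(maximalRealSubfield L),
            ((((∏ w' : PlacesOver L v, max 1 (max ((normAbs (w'.1.adicCompletion L) (quadraticLocalEquiv L v (IsCMField.complexConj L) hcδ hδ (p 0, p 1) w') : ℝ≥0) : ℝ)
          ((normAbs (w'.1.adicCompletion L) ((toLocalRing L v (p 2) * algebraMap L (LocalRing L v) δ -
            toLocalRing L v 2⁻¹ * (quadraticLocalEquiv L v (IsCMField.complexConj L) hcδ hδ (p 0, p 1) *
              conjLocal L (IsCMField.complexConj L) v (quadraticLocalEquiv L v (IsCMField.complexConj L) hcδ hδ (p 0, p 1)))) w') : ℝ≥0) : ℝ))) : ℝ) : ℂ) ^ (-z)) *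
              (∏ w' : PlacesOver L v, (adeleAddCharAt L w'.1 ((ξ : w'.1.adicCompletion L) * quadraticLocalEquiv L v (IsCMField.complexConj L) hcδ hδ (p 0, p 1) w') : ℂ))
            ∂(Measure.pi fun _ : Fin 3 => νv v) := by
      rw [hWloc, if_pos (show ∀ w' : PlacesOver L v, (ξ : w'.1.adicCompletion L) ∈ primePowBall (w'.1.adicCompletion L) (e w'.1) from fun w' => hbox w'.1)]
    have h1 := one_le_prod_extension_ite (K := ↥(maximalRealSubfield L)) (∅ : Finset (HeightOneSpectrum (𝓞 L)))
      (fun w : HeightOneSpectrum (𝓞 L) => (-WithZero.log (w.valuation L ξ) - e w).toNat) v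
    rw [hWv]
    by_cases hv₀ : v ∈ S₀
    · rw [if_pos hv₀]
      calc ‖((Measure.pi fun _ : Fin 3 => νv v) (integralBox ↥(maximalRealSubfield L) (Fin 3) v)).toReal⁻¹ •
          ∫ p : Fin 3 → v.adicCompletion ↥(maximalRealSubfield L),
            ((((∏ w' : PlacesOver L v, max 1 (max ((normAbs (w'.1.adicCompletion L) (quadraticLocalEquiv L v (IsCMField.complexConj L) hcδ hδ (p 0, p 1) w') : ℝ≥0) : ℝ)
          ((normAbs (w'.1.adicCompletion L) ((toLocalRing L v (p 2) * algebraMap L (LocalRing L v) δ -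
            toLocalRing L v 2⁻¹ * (quadraticLocalEquiv L v (IsCMField.complexConj L) hcδ hδ (p 0, p 1) *
              conjLocal L (IsCMField.complexConj L) v (quadraticLocalEquiv L v (IsCMField.complexConj L) hcδ hδ (p 0, p 1)))) w') : ℝ≥0) : ℝ))) : ℝ) : ℂ) ^ (-z)) *
              (∏ w' : PlacesOver L v, (adeleAddCharAt L w'.1 ((ξ : w'.1.adicCompletion L) * quadraticLocalEquiv L v (IsCMField.complexConj L) hcδ hδ (p 0, p 1) w') : ℂ))
            ∂(Measure.pi fun _ : Fin 3 => νv v)‖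
          ≤ M v := norm_token_le_of_integrable L hcδ hδ v (νv v) (fun w' : PlacesOver L v => (ξ : w'.1.adicCompletion L)) (hT v hv₀ σ₁ hσ₁) hz
        _ ≤ 1 + ∑ v' ∈ S₀, M v' := (Finset.single_le_sum (fun v' _ => hM0 v') hv₀).trans (le_add_of_nonneg_left zero_le_one)
        _ ≤ (1 + ∑ v' ∈ S₀, M v') * _ := le_mul_of_one_le_right (by linarith [Finset.sum_nonneg fun v' (_ : v' ∈ S₀) => hM0 v']) (one_le_pow₀ h1)
    · rw [if_neg hv₀, one_mul]
      obtain ⟨hunr, h2, hδu⟩ := hgood v hv₀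
      obtain ⟨w', hw'⟩ := hSout ξ hξ v hv hv₀
      have hew : e w'.1 = 0 := he_zero hv₀ w'
      have hn1 : 1 ≤ (-WithZero.log (w'.1.valuation L ξ) - e w'.1).toNat :=
        one_le_shellIndex_of_valuation_ne w'.1 hξ (hbox w'.1) (by rw [hew, neg_zero, WithZero.exp_zero]; exact hw')
      have h4 := four_le_prod_extension_ite_of_exists (K := ↥(maximalRealSubfield L)) (∅ : Finset (HeightOneSpectrum (𝓞 L)))
        (fun w : HeightOneSpectrum (𝓞 L) => (-WithZero.log (w.valuation L ξ) - e w).toNat) v ⟨⟨w'.1, w'.2⟩, hn1⟩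
      have hq : 2 ≤ v.residueCard := NumberField.HeightOneSpectrum.one_lt_absNorm v
      have hε : ‖(quadraticHeckeCharCM L).valueAtUniformizer v‖ ≤ 1 := (HeckeCharacter.norm_valueAtUniformizer_of_isUnitary (isUnitary_quadraticHeckeCharCM L) v).le
      calc ‖((Measure.pi fun _ : Fin 3 => νv v) (integralBox ↥(maximalRealSubfield L) (Fin 3) v)).toReal⁻¹ •
          ∫ p : Fin 3 → v.adicCompletion ↥(maximalRealSubfield L),
            ((((∏ w' : PlacesOver L v, max 1 (max ((normAbs (w'.1.adicCompletion L) (quadraticLocalEquiv L v (IsCMField.complexConj L) hcδ hδ (p 0, p 1) w') : ℝ≥0) : ℝ)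
          ((normAbs (w'.1.adicCompletion L) ((toLocalRing L v (p 2) * algebraMap L (LocalRing L v) δ -
            toLocalRing L v 2⁻¹ * (quadraticLocalEquiv L v (IsCMField.complexConj L) hcδ hδ (p 0, p 1) *
              conjLocal L (IsCMField.complexConj L) v (quadraticLocalEquiv L v (IsCMField.complexConj L) hcδ hδ (p 0, p 1)))) w') : ℝ≥0) : ℝ))) : ℝ) : ℂ) ^ (-z)) *
              (∏ w' : PlacesOver L v, (adeleAddCharAt L w'.1 ((ξ : w'.1.adicCompletion L) * quadraticLocalEquiv L v (IsCMField.complexConj L) hcδ hδ (p 0, p 1) w') : ℂ))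
            ∂(Measure.pi fun _ : Fin 3 => νv v)‖
          ≤ 8 / ((1 - (2 : ℝ) ^ (-(σ₁ - 1))) ^ 2 * (1 - (2 : ℝ) ^ (-(2 * σ₁ - 2)))) :=
            norm_token_le_uniform_of_good L hcδ hδ hd v (νv v) hunr h2 hδu hq hε (fun w' : PlacesOver L v => (ξ : w'.1.adicCompletion L)) hσ₁ hz
        _ ≤ (4 : ℝ) ^ kk := hkk.le
        _ ≤ _ := pow_le_pow_left₀ (by norm_num) h4 kk
  -- (hn): order honesty is the definition of the shell index
  have hn : ∀ ξ : L, ξ ≠ 0 → (∀ w : HeightOneSpectrum (𝓞 L), (ξ : w.adicCompletion L) ∈ primePowBall (w.adicCompletion L) (e w)) →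
      ∀ v ∈ S ξ, ∀ w : v.Extension (𝓞 L), (w.1 ∈ (∅ : Finset (HeightOneSpectrum (𝓞 L))) ∨ 1 ≤ (fun (ξ : L) (w : HeightOneSpectrum (𝓞 L)) => (-WithZero.log (w.valuation L ξ) - e w).toNat) ξ w.1) →
        (ξ : w.1.adicCompletion L) ∈ primePowBall (w.1.adicCompletion L) (e w.1 + (fun (ξ : L) (w : HeightOneSpectrum (𝓞 L)) => (-WithZero.log (w.valuation L ξ) - e w).toNat) ξ w.1) ∧
          (ξ : w.1.adicCompletion L) ∉ primePowBall (w.1.adicCompletion L) (e w.1 + (fun (ξ : L) (w : HeightOneSpectrum (𝓞 L)) => (-WithZero.log (w.valuation L ξ) - e w).toNat) ξ w.1 + 1) :=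
    fun ξ hξ hbox v _ w _ => mem_shell_of_mem_primePowBall w.1 hξ (hbox w.1)
  -- (hvan): built in
  have hvan' : ∀ ξ : L, ξ ≠ 0 → ∀ w : HeightOneSpectrum (𝓞 L), (ξ : w.adicCompletion L) ∉ primePowBall (w.adicCompletion L) (e w) →
      w.under (𝓞 ↥(maximalRealSubfield L)) ∈ S ξ ∧ Wloc ξ (w.under (𝓞 ↥(maximalRealSubfield L))) = 0 := by
    intro ξ hξ w hw
    refine ⟨?_, funext fun z => ?_⟩
    · by_cases hew : e w = 0
      · rw [hew] at hw
        exact hSmem ξ hξ w (valuation_ne_one_of_not_mem_primePowBall_zero w hw)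
      · exact hS₀ ξ (he₀ w hew)
    · rw [hWloc, if_neg]
      · rfl
      · intro h
        exact hw (h ⟨w, rfl⟩)
  obtain ⟨hFhol, hFbd, hFsupp⟩ := exists_finitePart_bounds_of_packages_cm Wloc S he
    (fun (ξ : L) (w : HeightOneSpectrum (𝓞 L)) => (-WithZero.log (w.valuation L ξ) - e w).toNat) S₀ ∅ hhol hbd hn hvan'
  -- (3) the `D`-letters (★ W3₃-A, ★ DEN-BOUNDS-UNIFORM₃) and ★ C3₃-A
  have hDbd : ∀ σ₁ : ℝ, 1 < σ₁ → ∃ C : ℝ, 0 ≤ C ∧ ∀ (ξ : L) (z : ℂ), σ₁ ≤ z.re →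
      ‖(partialStandardL (↑(S ξ) : Set (HeightOneSpectrum (𝓞 ↥(maximalRealSubfield L)))) (fun _ => {1}) z *
              partialStandardL (↑(S ξ) : Set (HeightOneSpectrum (𝓞 ↥(maximalRealSubfield L)))) (fun v => {(quadraticHeckeCharCM L).valueAtUniformizer v}) z *
              partialStandardL (↑(S ξ) : Set (HeightOneSpectrum (𝓞 ↥(maximalRealSubfield L)))) (fun v => {(quadraticHeckeCharCM L).valueAtUniformizer v}) (2 * z - 1))⁻¹‖ ≤ C := by
    intro σ₁ hσ₁
    obtain ⟨C, hC, h⟩ := norm_den_inv_le_uniform_cm L hσ₁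
    exact ⟨C, hC.le, fun ξ z hz => h _ z hz⟩
  obtain ⟨-, hWhol, hWbd⟩ := whittaker_hWhol_hWbd_of_letters L (fun w : InfinitePlace L => (w δ : ℝ)) (fun (ξ : L) (w : InfinitePlace L) => (w.embedding ξ : ℂ)) one_pos
    (norm_mixedEmbedding_le_norm_embedding L)
    (fun _ : ℂ => (((((((volume : Measure (mixedSpace L)).prod μEf).map σE) (adeleFundamentalDomain L)).toReal⁻¹ : ℝ) : ℂ) * ((((((volume : Measure (mixedSpace ↥(maximalRealSubfield L))).prod μFf).map σF) (adeleFundamentalDomain ↥(maximalRealSubfield L))).toReal⁻¹ : ℝ) : ℂ) * φ₀ * (C' : ℂ) *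
            ((((Measure.pi fun _ : Fin 3 => μFf) (offBox (K := ↥(maximalRealSubfield L)) (ι := Fin 3) ∅)).toReal : ℂ)) : ℂ)) (differentiableOn_const _)
    (fun z₀ _ => ⟨univ, univ_mem, ‖(((((((volume : Measure (mixedSpace L)).prod μEf).map σE) (adeleFundamentalDomain L)).toReal⁻¹ : ℝ) : ℂ) * ((((((volume : Measure (mixedSpace ↥(maximalRealSubfield L))).prod μFf).map σF) (adeleFundamentalDomain ↥(maximalRealSubfield L))).toReal⁻¹ : ℝ) : ℂ) * φ₀ * (C' : ℂ) *
            ((((Measure.pi fun _ : Fin 3 => μFf) (offBox (K := ↥(maximalRealSubfield L)) (ι := Fin 3) ∅)).toReal : ℂ)) : ℂ)‖, norm_nonneg _, fun z _ => le_rfl⟩)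
    (fun (z : ℂ) (ξ : L) => ∏ v ∈ S ξ, Wloc ξ v z) he (fun ξ _ => hFhol ξ) hFbd hFsupp
    (fun (ξ : L) (z : ℂ) => (partialStandardL (↑(S ξ) : Set (HeightOneSpectrum (𝓞 ↥(maximalRealSubfield L)))) (fun _ => {1}) z *
              partialStandardL (↑(S ξ) : Set (HeightOneSpectrum (𝓞 ↥(maximalRealSubfield L)))) (fun v => {(quadraticHeckeCharCM L).valueAtUniformizer v}) z *
              partialStandardL (↑(S ξ) : Set (HeightOneSpectrum (𝓞 ↥(maximalRealSubfield L)))) (fun v => {(quadraticHeckeCharCM L).valueAtUniformizer v}) (2 * z - 1))⁻¹)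
    (fun ξ => differentiableOn_den_inv_cm L _) hDbd
  refine ⟨fun (z : ℂ) (ξ : L) => if ξ = 0 then (0 : ℂ) else (((((((volume : Measure (mixedSpace L)).prod μEf).map σE) (adeleFundamentalDomain L)).toReal⁻¹ : ℝ) : ℂ) * ((((((volume : Measure (mixedSpace ↥(maximalRealSubfield L))).prod μFf).map σF) (adeleFundamentalDomain ↥(maximalRealSubfield L))).toReal⁻¹ : ℝ) : ℂ) * φ₀ * (C' : ℂ) *
            ((((Measure.pi fun _ : Fin 3 => μFf) (offBox (K := ↥(maximalRealSubfield L)) (ι := Fin 3) ∅)).toReal : ℂ)) : ℂ) *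
      (∏ w : InfinitePlace L, 2 * (π : ℂ) ^ 2 * (4 : ℂ) ^ (1 - z) * (((w δ : ℝ)) : ℂ)⁻¹ * (Complex.Gamma z)⁻¹ ^ 2 *
          mellin (fun t : ℝ => Complex.exp (-(t : ℂ) - ((8 * π ^ 2 * ‖w.embedding ξ‖ ^ 2 : ℝ) : ℂ) / (t : ℂ))) (2 * z - 2)) * (∏ v ∈ S ξ, Wloc ξ v z) *
      (partialStandardL (↑(S ξ) : Set (HeightOneSpectrum (𝓞 ↥(maximalRealSubfield L)))) (fun _ => {1}) z *
              partialStandardL (↑(S ξ) : Set (HeightOneSpectrum (𝓞 ↥(maximalRealSubfield L)))) (fun v => {(quadraticHeckeCharCM L).valueAtUniformizer v}) z *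
              partialStandardL (↑(S ξ) : Set (HeightOneSpectrum (𝓞 ↥(maximalRealSubfield L)))) (fun v => {(quadraticHeckeCharCM L).valueAtUniformizer v}) (2 * z - 1))⁻¹, hWhol, hWbd, fun z hz ξ hξ hfin hW => ?_⟩
  -- (4) `hWeq` on the window: ★ U3C at `S₀ := S(ξ)`, `S := S(ξ)`
  have hgood' : ∀ v ∉ S ξ, Algebra.IsUnramifiedIn (𝓞 L) v.asIdeal ∧ Valued.v (2 : v.adicCompletion ↥(maximalRealSubfield L)) = 1 ∧
      ∀ w : PlacesOver L v, Valued.v (algebraMap L (LocalRing L v) δ w) = 1 := fun v hv => hgood v (hSnot ξ hξ v hv).1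
  have hξ' : ∀ v ∉ S ξ, ∀ w' : PlacesOver L v, (ξ : w'.1.adicCompletion L) ∈ w'.1.adicCompletionIntegers L :=
    fun v hv w' => coe_mem_adicCompletionIntegers_of_valuation_eq_one w'.1 ((hSnot ξ hξ v hv).2 w')
  have hW' : ∀ v ∉ S ξ, ((Measure.pi fun _ : Fin 3 => νv v) (integralBox ↥(maximalRealSubfield L) (Fin 3) v)).toReal⁻¹ •
          ∫ p : Fin 3 → v.adicCompletion ↥(maximalRealSubfield L),
            ((((∏ w' : PlacesOver L v, max 1 (max ((normAbs (w'.1.adicCompletion L) (quadraticLocalEquiv L v (IsCMField.complexConj L) hcδ hδ (p 0, p 1) w') : ℝ≥0) : ℝ)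
          ((normAbs (w'.1.adicCompletion L) ((toLocalRing L v (p 2) * algebraMap L (LocalRing L v) δ -
            toLocalRing L v 2⁻¹ * (quadraticLocalEquiv L v (IsCMField.complexConj L) hcδ hδ (p 0, p 1) *
              conjLocal L (IsCMField.complexConj L) v (quadraticLocalEquiv L v (IsCMField.complexConj L) hcδ hδ (p 0, p 1)))) w') : ℝ≥0) : ℝ))) : ℝ) : ℂ) ^ (-z)) *
              (∏ w' : PlacesOver L v, (adeleAddCharAt L w'.1 ((ξ : w'.1.adicCompletion L) * quadraticLocalEquiv L v (IsCMField.complexConj L) hcδ hδ (p 0, p 1) w') : ℂ))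
            ∂(Measure.pi fun _ : Fin 3 => νv v) =
      (1 - (v.residueCard : ℂ) ^ (-z)) * (1 - (quadraticHeckeCharCM L).valueAtUniformizer v * (v.residueCard : ℂ) ^ (-z)) *
        (1 - (quadraticHeckeCharCM L).valueAtUniformizer v * (v.residueCard : ℂ) ^ (-(2 * z - 1))) := fun v hv => hW v (hSnot ξ hξ v hv).1 (hSnot ξ hξ v hv).2
  have key := hU3C (S ξ) hgood' ξ hξ' (S ξ) hz hfin hW'
  rw [key]
  simp only [if_neg hξ]
  by_cases hbox : ∀ w : HeightOneSpectrum (𝓞 L), (ξ : w.adicCompletion L) ∈ primePowBall (w.adicCompletion L) (e w)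
  · have hprod : ∏ v ∈ S ξ, Wloc ξ v z = ∏ v ∈ S ξ, ((Measure.pi fun _ : Fin 3 => νv v) (integralBox ↥(maximalRealSubfield L) (Fin 3) v)).toReal⁻¹ •
          ∫ p : Fin 3 → v.adicCompletion ↥(maximalRealSubfield L),
            ((((∏ w' : PlacesOver L v, max 1 (max ((normAbs (w'.1.adicCompletion L) (quadraticLocalEquiv L v (IsCMField.complexConj L) hcδ hδ (p 0, p 1) w') : ℝ≥0) : ℝ)
          ((normAbs (w'.1.adicCompletion L) ((toLocalRing L v (p 2) * algebraMap L (LocalRing L v) δ -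
            toLocalRing L v 2⁻¹ * (quadraticLocalEquiv L v (IsCMField.complexConj L) hcδ hδ (p 0, p 1) *
              conjLocal L (IsCMField.complexConj L) v (quadraticLocalEquiv L v (IsCMField.complexConj L) hcδ hδ (p 0, p 1)))) w') : ℝ≥0) : ℝ))) : ℝ) : ℂ) ^ (-z)) *
              (∏ w' : PlacesOver L v, (adeleAddCharAt L w'.1 ((ξ : w'.1.adicCompletion L) * quadraticLocalEquiv L v (IsCMField.complexConj L) hcδ hδ (p 0, p 1) w') : ℂ))
            ∂(Measure.pi fun _ : Fin 3 => νv v) :=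
      Finset.prod_congr rfl fun v _ => by
        rw [hWloc, if_pos (show ∀ w' : PlacesOver L v, (ξ : w'.1.adicCompletion L) ∈ primePowBall (w'.1.adicCompletion L) (e w'.1) from fun w' => hbox w'.1)]
    rw [hprod]
    ring
  · push Not at hbox
    obtain ⟨w, hw⟩ := hbox
    have h0 : ∏ v ∈ S ξ, Wloc ξ v z = 0 := hFsupp ξ hξ ⟨w, hw⟩ z
    have h0' : ∏ v ∈ S ξ, ((Measure.pi fun _ : Fin 3 => νv v) (integralBox ↥(maximalRealSubfield L) (Fin 3) v)).toReal⁻¹ •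
          ∫ p : Fin 3 → v.adicCompletion ↥(maximalRealSubfield L),
            ((((∏ w' : PlacesOver L v, max 1 (max ((normAbs (w'.1.adicCompletion L) (quadraticLocalEquiv L v (IsCMField.complexConj L) hcδ hδ (p 0, p 1) w') : ℝ≥0) : ℝ)
          ((normAbs (w'.1.adicCompletion L) ((toLocalRing L v (p 2) * algebraMap L (LocalRing L v) δ -
            toLocalRing L v 2⁻¹ * (quadraticLocalEquiv L v (IsCMField.complexConj L) hcδ hδ (p 0, p 1) *
              conjLocal L (IsCMField.complexConj L) v (quadraticLocalEquiv L v (IsCMField.complexConj L) hcδ hδ (p 0, p 1)))) w') : ℝ≥0) : ℝ))) : ℝ) : ℂ) ^ (-z)) *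
              (∏ w' : PlacesOver L v, (adeleAddCharAt L w'.1 ((ξ : w'.1.adicCompletion L) * quadraticLocalEquiv L v (IsCMField.complexConj L) hcδ hδ (p 0, p 1) w') : ℂ))
            ∂(Measure.pi fun _ : Fin 3 => νv v) = 0 :=
      Finset.prod_eq_zero (hvan' ξ hξ w hw).1 (hvan ξ hξ w hw z hz)
    rw [h0, h0']
    ring

end Head

end Summit.HodgeConjecture.HodgeConjecture.Cruxes.H413.K2E1WhittakerContinuationConcreteU3

end
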